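import Literature.NumberTheory.NumberFields.CyclicQuinticField2651K4
import Literature.NumberTheory.NumberFields.TableAlgebraTruncated
import Mathlib.RingTheory.Trace.Basic
import Mathlib.RingTheory.Norm.Transitivity
import Mathlib.Tactic.NormNum.Prime
import HarnessLib

/-!
# The cyclic quintic field of conductor `2651`, number `4`: the ring of integers is the order of orbit sums

Second file on `K = CyclicQuintic2651K4.K` (`CyclicQuinticField2651K4.lean`: the order `R = TAlg spec ℤ`
of the orbit sums `g b`, `liftK : R →+* K`, `Gal(K/ℚ) = ⟨σ⟩`). As for `K₂₄₁`
(`CyclicQuinticField241Integers.lean`) the ring of integers is computed without a power basis: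
**`𝓞 K = ℤg₀ ⊕ ⋯ ⊕ ℤg₄`** (`integerEquiv : R ≃+* 𝓞 K`), by the trace form and a LOCAL ARGUMENT AT THE
TWO RAMIFIED PRIMES `11`, `241` which does not need the (non-principal!) primes above them to be
generated by an element:

* norms and traces of `liftK y` are kernel-computable (`normT`, `trT y = Σ y_b`, as `Tr g_b = 1`); the Gram
  matrix of the trace form is `2651·I - 530·J` (`trace_g_mul`), so the `g b` are linearly independent,
  `liftK` is injective and **`2651 · 𝓞 K ⊆ Λ := liftK R`** (`2651 c_b = Tr(x g_b) + 530 Tr(x)`);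
* **`Λ` is saturated at `p = 11` and `p = 241`**: with `ε = g₀ - 9` (resp. `g₀ - 193`), `v_p(N ε) = 1`,
  `ε̄⁵ = 0` and `1, ε̄, …, ε̄⁴` span `Λ/pΛ` (kernel certificates), so by
  `TAlg.exists_pow_mul_eq_const_mul_pow_four` a `y ∈ Λ ∖ pΛ` with `y/p` integral would make `ε⁴/p`
  integral, contradicting `N(ε)⁴/p⁵ ∉ ℤ` (`saturated_eleven`, `saturated_241`); hence **`𝓞 K = Λ`**.

## References

* M. Pohst, H. Zassenhaus, *Algorithmic Algebraic Number Theory* (1989), §4.6. [folklore]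
* T. Dokchitser, V. Dokchitser, J. Number Theory 131 (2011) 1833–1839, proof of Thm. 2. [DokchitserDokchitser2011RankModN]
-/

noncomputable section

open NumberField

namespace Literature.NumberTheory.NumberFields

namespace CyclicQuintic2651K4

/-! ### Traces and norms of elements of `Λ` -/

/-- **The trace form of the order**: `trT y = y₀ + ⋯ + y₄` (as `Tr g_b = 1`). [folklore] -/
def trT (u : R) : ℤ := ∑ b, u.coef b

/-- Coordinates of `shift u`: `(shift u)₀ = u₄`, …, `(shift u)₄ = u₃`. [folklore] -/
theorem shift_coef (u : R) : (shift u).coef 0 = u.coef 4 ∧ (shift u).coef 1 = u.coef 0 ∧ (shift u).coef 2 = u.coef 1 ∧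
    (shift u).coef 3 = u.coef 2 ∧ (shift u).coef 4 = u.coef 3 := ⟨rfl, rfl, rfl, rfl, rfl⟩

/-- `Σ_{i<5} shiftⁱ u = trT u` (a constant, `1 = g₀ + ⋯ + g₄`). [folklore] -/
theorem sum_shift (u : R) :
    u + shift u + shift (shift u) + shift (shift (shift u)) + shift (shift (shift (shift u))) = (trT u : R) := by
  have h := fun v : R => shift_coef v
  ext a
  fin_cases a <;>
    simp only [TAlg.add_coef, (h _).1, (h _).2.1, (h _).2.2.1, (h _).2.2.2.1, (h _).2.2.2.2, TAlg.intCast_coef, spec,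
      mul_one, trT, Fin.sum_univ_five, Int.cast_id, Fin.zero_eta, Fin.mk_one, Fin.reduceFinMk, Fin.isValue] <;> ring

/-- **The norm form** `N(u) = u · σu · σ²u · σ³u · σ⁴u`, computably. [folklore] -/
def normT (u : R) : R :=
  u * shift u * shift (shift u) * shift (shift (shift u)) * shift (shift (shift (shift u)))

/-- `σⁱ (liftK y) = liftK (shiftⁱ y)`. [folklore] -/
theorem σ_iterate_liftK (n : ℕ) (y : R) : σ^[n] (liftK y) = liftK (shift^[n] y) := by
  induction n with
  | zero => rfl
  | succ n ih => rw [Function.iterate_succ_apply', Function.iterate_succ_apply', ih, liftK_shift]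

/-- **`N_{K/ℚ}(liftK y) = liftK (normT y)`.** [folklore] -/
theorem algebraMap_norm_liftK (y : R) :
    algebraMap ℚ K (Algebra.norm ℚ (liftK y)) = liftK (normT y) := by
  rw [norm_eq_prod_pow_σ, Fin.prod_univ_five]
  simp only [σ_pow_apply, σ_iterate_liftK, normT, map_mul]
  simp only [Fin.val_zero, Fin.val_one, Fin.val_two, Function.iterate_zero, Function.iterate_succ,
    Function.comp_apply, id]
  norm_num

/-- **Norms by kernel computation**: if `normT y = m` then `N_{K/ℚ}(liftK y) = m`. [folklore] -/
theorem norm_liftK_of_normT_eq {y : R} {m : ℤ} (h : normT y = (m : R)) : Algebra.norm ℚ (liftK y) = m := by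
  apply (algebraMap ℚ K).injective
  rw [algebraMap_norm_liftK, h, map_intCast, map_intCast]

/-- **`Tr_{K/ℚ}(liftK y) = trT y`.** [folklore] -/
theorem trace_liftK (y : R) : Algebra.trace ℚ K (liftK y) = trT y := by
  apply (algebraMap ℚ K).injective
  rw [trace_eq_sum_automorphisms,
    ← (Fintype.sum_bijective _ σ_pow_bijective (fun i : Fin 5 => (σ ^ (i : ℕ)) (liftK y))
      (fun g => g (liftK y)) fun _ => rfl), Fin.sum_univ_five, map_intCast, ← map_intCast liftK, ← sum_shift]
  simp only [σ_pow_apply, σ_iterate_liftK, map_add]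
  simp only [Fin.val_zero, Fin.val_one, Fin.val_two, Function.iterate_zero, Function.iterate_succ,
    Function.comp_apply, id]
  norm_num

/-- `g a * g b = liftK (basis a * basis b)`. [folklore] -/
theorem g_mul_g (a b : Fin 5) : g a * g b = liftK (TAlg.basis a * TAlg.basis b) := by
  rw [map_mul, liftK_basis, liftK_basis]

/-- The Gram matrix in the order: `trT (basis a * basis b) = 2121` if `a = b`, `-530` otherwise. [folklore] -/
theorem trT_basis_mul_basis : ∀ a b : Fin 5, trT (TAlg.basis a * TAlg.basis b : R) = if a = b then 2121 else -530 := by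
  decide +kernel

/-- `trT (basis b) = 1`. [folklore] -/
theorem trT_basis : ∀ b : Fin 5, trT (TAlg.basis b : R) = 1 := by
  decide +kernel

/-- **The trace form on the orbit sums**: `Tr(g a · g b) = 2121 = 2651 - 530` if `a = b`, `-530` otherwise. [folklore] -/
theorem trace_g_mul (a b : Fin 5) : Algebra.trace ℚ K (g a * g b) = if a = b then 2121 else -530 := by
  rw [g_mul_g, trace_liftK, trT_basis_mul_basis, Int.cast_ite]
  norm_num

/-- `Tr(g b) = 1`. [folklore] -/
theorem trace_g (b : Fin 5) : Algebra.trace ℚ K (g b) = 1 := by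
  rw [← liftK_basis, trace_liftK, trT_basis]
  norm_num

/-! ### The orbit sums are a `ℚ`-basis of `K`; `liftK` is injective -/

/-- Trace of `(Σ c_b g_b) · g a`: `2651 c_a - 530 Σ c_b`. [folklore] -/
theorem trace_sum_smul_mul (c : Fin 5 → ℚ) (a : Fin 5) :
    Algebra.trace ℚ K ((∑ b, c b • g b) * g a) = 2651 * c a - 530 * ∑ b, c b := by
  rw [Finset.sum_mul, map_sum]
  simp only [smul_mul_assoc, map_smul, trace_g_mul, smul_eq_mul]
  rw [Fin.sum_univ_five, Fin.sum_univ_five]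
  fin_cases a <;> simp <;> ring

/-- Trace of `Σ c_b g_b`: `Σ c_b`. [folklore] -/
theorem trace_sum_smul (c : Fin 5 → ℚ) : Algebra.trace ℚ K (∑ b, c b • g b) = ∑ b, c b := by
  rw [map_sum]
  simp only [map_smul, trace_g, smul_eq_mul, mul_one]

/-- **The orbit sums are linearly independent over `ℚ`** (Gram matrix `2651·I - 530·J`). [folklore] -/
theorem linearIndependent_g : LinearIndependent ℚ g := by
  rw [Fintype.linearIndependent_iff]
  intro c hc a
  have h1 := trace_sum_smul_mul c a
  have h2 := trace_sum_smul c
  rw [hc, zero_mul, map_zero] at h1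
  rw [hc, map_zero] at h2
  linarith

/-- **The basis of orbit sums of `K` over `ℚ`.** [folklore] -/
def basisK : Module.Basis (Fin 5) ℚ K :=
  basisOfLinearIndependentOfCardEqFinrank linearIndependent_g (by rw [Fintype.card_fin, finrank_K])

/-- `basisK b = g b`. [folklore] -/
@[simp] theorem basisK_apply (b : Fin 5) : basisK b = g b := by
  rw [basisK, coe_basisOfLinearIndependentOfCardEqFinrank]

/-- `liftK y = Σ y_b • g b`. [folklore] -/
theorem liftK_eq_sum (y : R) : liftK y = ∑ b, (y.coef b : ℚ) • g b := by
  rw [liftK, TableSpec.lift_apply]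
  refine Finset.sum_congr rfl fun b _ => ?_
  rw [Algebra.smul_def, map_intCast]

/-- **`liftK` is injective.** [folklore] -/
theorem liftK_injective : Function.Injective liftK := by
  refine (injective_iff_map_eq_zero liftK).mpr fun y hy => ?_
  rw [liftK_eq_sum] at hy
  have h := Fintype.linearIndependent_iff.mp linearIndependent_g _ hy
  ext b
  simpa using h b

/-! ### Integrality; `liftO : R →+* 𝓞 K` -/

/-- The orbit sums `g b = σᵇ θ` are algebraic integers. [folklore] -/
theorem isIntegral_g (b : Fin 5) : IsIntegral ℤ (g b) := by
  rw [← σ_iterate_θ, ← σ_pow_apply]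
  exact map_isIntegral_int _ isIntegral_θ

/-- Every element of `Λ` is an algebraic integer. [folklore] -/
theorem isIntegral_liftK (y : R) : IsIntegral ℤ (liftK y) := by
  rw [liftK, TableSpec.lift_apply]
  refine IsIntegral.sum _ fun b _ => ?_
  have hc : IsIntegral ℤ ((y.coef b : ℤ) : K) := by
    simpa using (isIntegral_algebraMap (R := ℤ) (A := K) (x := y.coef b))
  exact hc.mul (isIntegral_g b)

/-- **`liftO : R →+* 𝓞 K`**, the corestriction of `liftK`. [folklore] -/
def liftO : R →+* 𝓞 K where
  toFun y := ⟨liftK y, isIntegral_liftK y⟩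
  map_zero' := by ext; simp only [RingOfIntegers.map_mk, map_zero]
  map_one' := by ext; simp only [RingOfIntegers.map_mk, map_one]
  map_add' x y := by ext; simp only [RingOfIntegers.map_mk, map_add]
  map_mul' x y := by ext; simp only [RingOfIntegers.map_mk, map_mul]

/-- `(liftO y : K) = liftK y`. [folklore] -/
@[simp] theorem coe_liftO (y : R) : ((liftO y : 𝓞 K) : K) = liftK y := rfl

/-- `liftO` is injective. [folklore] -/
theorem liftO_injective : Function.Injective liftO := fun x y h =>
  liftK_injective (by rw [← coe_liftO, ← coe_liftO, h])

/-! ### The index bound from the trace form: `2651 · 𝓞 K ⊆ Λ` -/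

/-- The trace of an algebraic integer of `K` is a rational integer. [folklore] -/
theorem exists_int_eq_trace {x : K} (hx : IsIntegral ℤ x) : ∃ n : ℤ, (n : ℚ) = Algebra.trace ℚ K x := by
  obtain ⟨n, hn⟩ := IsIntegrallyClosed.isIntegral_iff.mp (Algebra.isIntegral_trace (L := ℚ) hx)
  exact ⟨n, by rw [← hn]; rfl⟩

/-- **`2651 · x ∈ Λ` for every algebraic integer `x`**: writing `x = Σ c_b g_b`,
`2651 c_a = Tr(x g_a) + 530 Tr(x)` is an integer. [folklore] -/
theorem exists_liftK_eq_mul_of_isIntegral {x : K} (hx : IsIntegral ℤ x) : ∃ y : R, liftK y = 2651 * x := by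
  set c : Fin 5 → ℚ := fun b => basisK.repr x b with hc
  have hxsum : x = ∑ b, c b • g b := by
    conv_lhs => rw [← basisK.sum_repr x]
    simp only [basisK_apply, hc]
  have ht : ∀ a, ∃ n : ℤ, (n : ℚ) = 2651 * c a - 530 * ∑ b, c b := fun a => by
    obtain ⟨n, hn⟩ := exists_int_eq_trace (hx.mul (isIntegral_g a))
    refine ⟨n, ?_⟩
    rw [hn, hxsum, trace_sum_smul_mul]
  obtain ⟨n, hn⟩ := exists_int_eq_trace hx
  rw [hxsum, trace_sum_smul] at hn
  choose t hts using ht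
  have hcoef : ∀ a, ((t a + 530 * n : ℤ) : ℚ) = 2651 * c a := fun a => by
    push_cast
    rw [hts, hn]
    ring
  refine ⟨⟨fun a => t a + 530 * n⟩, ?_⟩
  rw [liftK_eq_sum, hxsum, Finset.mul_sum]
  refine Finset.sum_congr rfl fun a _ => ?_
  rw [hcoef, Algebra.smul_def, Algebra.smul_def, map_mul, map_ofNat, mul_assoc]

/-! ### Saturation at the ramified primes `11` and `241` -/

/-- Reduction of the order modulo `m`. [folklore] -/
abbrev red (m : ℕ) : R →+* TAlg spec (ZMod m) := TAlg.map (Int.castRingHom (ZMod m))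

/-- **An element of `Λ ∖ pΛ` is never `p` times an algebraic integer**, if `Λ/pΛ = 𝔽_p[ε̄]/(ε̄⁵)` for an
`ε ∈ Λ` with `v_p(N ε) = 1` (the local argument at a totally ramified prime). [folklore] -/
theorem saturated_of_eps {p : ℕ} (hp : p.Prime) (ε : R) {m0 : ℤ} (hN : normT ε = ((p : ℤ) * m0 : ℤ))
    (hm0 : ¬ (p : ℤ) ∣ m0) (B : Fin 5 → Fin 5 → ZMod p)
    (hB : ∀ b, (TAlg.basis b : TAlg spec (ZMod p)) = ∑ k : Fin 5, TAlg.const (B b k) * red p ε ^ (k : ℕ))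
    (hε : red p ε ^ 5 = 0) (y : R) (t : K) (ht : IsIntegral ℤ t) (hy : liftK y = p * t) :
    ∃ y' : R, y = (p : R) * y' := by
  haveI := Fact.mk hp
  by_cases hred : red p y = 0
  · exact TAlg.exists_eq_natCast_mul_of_map_eq_zero p hred
  exfalso
  obtain ⟨k, -, c, hc, hkc⟩ := TAlg.exists_pow_mul_eq_const_mul_pow_four (red p ε) B hB hε hred
  -- lift `c` to an integer `c'` with `c' d ≡ 1 (mod p)`
  obtain ⟨c', rfl⟩ := ZMod.intCast_surjective c
  have hcop : IsCoprime (c' : ℤ) p := by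
    rw [Int.isCoprime_iff_gcd_eq_one]
    have hnd : ¬ (p : ℤ) ∣ c' := fun hdvd => hc (by rw [(ZMod.intCast_zmod_eq_zero_iff_dvd c' p).mpr hdvd])
    have := Int.gcd_dvd_right c' p
    rcases (Nat.dvd_prime hp).mp (by exact_mod_cast this) with h1 | h2
    · exact h1
    · exfalso; apply hnd
      have h := Int.gcd_dvd_left c' p
      rw [h2] at h; exact_mod_cast h
  obtain ⟨d, q, hdq⟩ := hcop
  -- the element `z = ε^k y - c' ε^4` reduces to `0`, so `z = p z'`
  have hz : red p (ε ^ k * y - (c' : R) * ε ^ 4) = 0 := by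
    rw [map_sub, map_mul, map_pow, hkc, map_mul, map_pow, sub_eq_zero]
    congr 1
    ext a; simp
  obtain ⟨z', hz'⟩ := TAlg.exists_eq_natCast_mul_of_map_eq_zero p hz
  -- in `K`: `c' E^4 = p (E^k t - liftK z')`, `E = liftK ε`
  have hp0 : (p : K) ≠ 0 := by exact_mod_cast hp.ne_zero
  have key : (c' : K) * liftK ε ^ 4 = p * (liftK ε ^ k * t - liftK z') := by
    have h := congrArg liftK hz'
    simp only [map_sub, map_mul, map_pow, map_intCast, map_natCast, hy] at h
    linear_combination (-1 : K) * h
  -- hence `E^4 / p = d (E^k t - liftK z') + q E^4` is integral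
  have hint : IsIntegral ℤ (liftK ε ^ 4 / p) := by
    have hdq' : (d : K) * c' + q * p = 1 := by exact_mod_cast hdq
    have e : liftK ε ^ 4 / p = (d : K) * (liftK ε ^ k * t - liftK z') + (q : K) * liftK ε ^ 4 := by
      rw [div_eq_iff hp0]
      linear_combination (-(liftK ε ^ 4)) * hdq' + (d : K) * key
    rw [e]
    refine IsIntegral.add (IsIntegral.mul ?_ ((((isIntegral_liftK ε).pow k).mul ht).sub (isIntegral_liftK z')))
      (IsIntegral.mul ?_ ((isIntegral_liftK ε).pow 4))
    · simpa using (isIntegral_algebraMap (R := ℤ) (A := K) (x := d))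
    · simpa using (isIntegral_algebraMap (R := ℤ) (A := K) (x := q))
  -- but the norm of `w = E⁴/p` would satisfy `p⁵ N(w) = N(ε)⁴ = p⁴ m0⁴`, i.e. `p ∣ m0⁴`
  obtain ⟨r, hr⟩ := IsIntegrallyClosed.isIntegral_iff.mp (Algebra.isIntegral_norm ℚ hint)
  have hNE : Algebra.norm ℚ (liftK ε) = (p : ℚ) * m0 := by
    rw [norm_liftK_of_normT_eq hN]; push_cast; ring
  have hw : (p : K) * (liftK ε ^ 4 / p) = liftK ε ^ 4 := mul_div_cancel₀ _ hp0
  have hnp : Algebra.norm ℚ (p : K) = (p : ℚ) ^ 5 := by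
    rw [show (p : K) = algebraMap ℚ K (p : ℚ) by simp, Algebra.norm_algebraMap, finrank_K]
  have hnorm := congrArg (Algebra.norm ℚ) hw
  rw [map_mul, hnp, map_pow, hNE, ← hr] at hnorm
  have h3 : (p : ℤ) ^ 5 * r = ((p : ℤ) * m0) ^ 4 := by
    have h' : (p : ℚ) ^ 5 * (r : ℚ) = ((p : ℚ) * m0) ^ 4 := by rw [← hnorm]; rfl
    exact_mod_cast h'
  have hp' : (p : ℤ) ≠ 0 := by exact_mod_cast hp.ne_zero
  have hdvd : (p : ℤ) ∣ m0 ^ 4 := ⟨r, by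
    apply mul_left_cancel₀ (pow_ne_zero 4 hp')
    linear_combination -h3⟩
  exact hm0 ((Int.prime_iff_natAbs_prime.mpr (by simpa using hp)).dvd_of_dvd_pow hdvd)

/-- `ε = g₀ - 9 ∈ Λ`, an element of the prime above `11` outside its square. [folklore] -/
def eps11 : R := ⟨![-8, -9, -9, -9, -9]⟩

/-- `N(ε) = -28809 = 11 · -2619` (kernel computation of the norm form). [folklore] -/
theorem normT_eps11 : normT eps11 = ((11 : ℤ) * -2619 : ℤ) := by
  decide +kernel

/-- The coordinates of the basis on the powers of `ε̄` in `Λ/11Λ`. [folklore] -/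
def B11 : Fin 5 → Fin 5 → ZMod 11 := fun b k => ((![![9, 1, 0, 0, 0], ![9, 4, 7, 7, 4], ![9, 5, 8, 10, 2], ![9, 9, 9, 1, 2], ![9, 3, 9, 4, 3]] : Fin 5 → Fin 5 → ℤ) b k : ZMod 11)

/-- **`1, ε̄, …, ε̄⁴` span `Λ/11Λ`** (kernel check of the coordinate certificate). [folklore] -/
theorem basis_eq_sum_pow_eps11 :
    ∀ b, (TAlg.basis b : TAlg spec (ZMod 11)) = ∑ k : Fin 5, TAlg.const (B11 b k) * red 11 eps11 ^ (k : ℕ) := by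
  decide +kernel

/-- **`ε̄⁵ = 0` in `Λ/11Λ`** (`11` is totally ramified). [folklore] -/
theorem red_eps11_pow_five : red 11 eps11 ^ 5 = 0 := by
  decide +kernel

/-- **`Λ ∩ 11·𝓞 = 11Λ`.** [folklore] -/
theorem saturated_11 (y : R) (t : K) (ht : IsIntegral ℤ t) (hy : liftK y = 11 * t) : ∃ y' : R, y = (11 : R) * y' := by
  have h := saturated_of_eps (by norm_num) eps11 normT_eps11 (by norm_num) B11 basis_eq_sum_pow_eps11
    red_eps11_pow_five y t ht (by exact_mod_cast hy)
  simpa using h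

/-- `ε = g₀ - 193 ∈ Λ`, an element of the prime above `241` outside its square. [folklore] -/
def eps241 : R := ⟨![-192, -193, -193, -193, -193]⟩

/-- `N(ε) = -259456233321 = 241 · -1076581881` (kernel computation of the norm form). [folklore] -/
theorem normT_eps241 : normT eps241 = ((241 : ℤ) * -1076581881 : ℤ) := by
  decide +kernel

/-- The coordinates of the basis on the powers of `ε̄` in `Λ/241Λ`. [folklore] -/
def B241 : Fin 5 → Fin 5 → ZMod 241 := fun b k => ((![![193, 1, 0, 0, 0], ![193, 91, 38, 67, 82], ![193, 87, 16, 188, 237], ![193, 205, 119, 62, 64], ![193, 98, 68, 165, 99]] : Fin 5 → Fin 5 → ℤ) b k : ZMod 241)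

/-- **`1, ε̄, …, ε̄⁴` span `Λ/241Λ`** (kernel check of the coordinate certificate). [folklore] -/
theorem basis_eq_sum_pow_eps241 :
    ∀ b, (TAlg.basis b : TAlg spec (ZMod 241)) = ∑ k : Fin 5, TAlg.const (B241 b k) * red 241 eps241 ^ (k : ℕ) := by
  decide +kernel

/-- **`ε̄⁵ = 0` in `Λ/241Λ`** (`241` is totally ramified). [folklore] -/
theorem red_eps241_pow_five : red 241 eps241 ^ 5 = 0 := by
  decide +kernel

/-- **`Λ ∩ 241·𝓞 = 241Λ`.** [folklore] -/
theorem saturated_241 (y : R) (t : K) (ht : IsIntegral ℤ t) (hy : liftK y = 241 * t) : ∃ y' : R, y = (241 : R) * y' := by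
  have h := saturated_of_eps (by norm_num) eps241 normT_eps241 (by norm_num) B241 basis_eq_sum_pow_eps241
    red_eps241_pow_five y t ht (by exact_mod_cast hy)
  simpa using h

/-! ### `𝓞 K = Λ` -/

/-- **Every algebraic integer of `K` lies in `Λ = ⊕ ℤ g_b`** (`2651 x ∈ Λ`, then divide by `11` and by
`241` using saturation). [folklore] -/
theorem exists_liftK_eq_of_isIntegral {x : K} (hx : IsIntegral ℤ x) : ∃ y : R, liftK y = x := by
  obtain ⟨y, hy⟩ := exists_liftK_eq_mul_of_isIntegral hx
  have hx241 : IsIntegral ℤ ((241 : K) * x) := by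
    have h : IsIntegral ℤ (((241 : ℤ) : K)) := by
      simpa using isIntegral_algebraMap (R := ℤ) (A := K) (x := (241 : ℤ))
    simpa using h.mul hx
  obtain ⟨y1, hy1⟩ := saturated_11 y ((241 : K) * x) hx241 (by rw [hy]; ring)
  have hly1 : liftK y1 = 241 * x := by
    have h := hy
    rw [hy1, map_mul, map_ofNat] at h
    apply mul_left_cancel₀ (by norm_num : (11 : K) ≠ 0)
    linear_combination h
  obtain ⟨y2, hy2⟩ := saturated_241 y1 x hx (by rw [hly1])
  refine ⟨y2, ?_⟩
  have h := hly1
  rw [hy2, map_mul, map_ofNat] at h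
  exact mul_left_cancel₀ (by norm_num : (241 : K) ≠ 0) (by linear_combination h)

/-- **Membership in `Λ` is integrality.** [folklore] -/
theorem mem_range_liftK_iff (x : K) : x ∈ liftK.range ↔ IsIntegral ℤ x :=
  ⟨fun ⟨y, hy⟩ => hy ▸ isIntegral_liftK y, fun hx => exists_liftK_eq_of_isIntegral hx⟩

/-- `liftO` is surjective. [folklore] -/
theorem liftO_surjective : Function.Surjective liftO := fun x => by
  obtain ⟨y, hy⟩ := exists_liftK_eq_of_isIntegral x.isIntegral_coe
  exact ⟨y, RingOfIntegers.ext (by simpa using hy)⟩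

/-- **`𝓞 K ≅ R`**: the ring of integers is the order of orbit sums `ℤg₀ ⊕ ⋯ ⊕ ℤg₄`. [folklore] -/
def integerEquiv : R ≃+* 𝓞 K :=
  RingEquiv.ofBijective liftO ⟨liftO_injective, liftO_surjective⟩

/-- `integerEquiv y = liftO y`. [folklore] -/
@[simp] theorem integerEquiv_apply (y : R) : integerEquiv y = liftO y := rfl

/-- `(integerEquiv y : K) = liftK y`. [folklore] -/
theorem coe_integerEquiv (y : R) : ((integerEquiv y : 𝓞 K) : K) = liftK y := rfl

/-- `integerEquiv (basis b) = g b`. [folklore] -/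
theorem coe_integerEquiv_basis (b : Fin 5) : ((integerEquiv (TAlg.basis b) : 𝓞 K) : K) = g b := by
  rw [coe_integerEquiv, liftK_basis]

end CyclicQuintic2651K4

end Literature.NumberTheory.NumberFields

end
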